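import Mathlib
import Summits.ValiantsHypothesis.ValiantsHypothesis.Theses.ValuativeGCT

/-!
# Glue of the split of `ValuativeGCT.ValuativeFlip`: the three support items
# `ValuativeFlipSplit` (stmt-ValiantsHypothesis-15688), `ValuativeFlipToHead` (stmt-15804),
# `ValuativeFlipToTail` (stmt-15805) — candidate proofs

Pure logic over the route file (no other import), written by wall-breaker k16 gen 1 of the parent crux
(stmt-12624) as a CANDIDATE PROOF attached to the three items; the stronger facts
`TailFlip → ValuativeFlip`, `TailFlip ↔ ValuativeFlip`, `TailFlip → HeadFlip` are landed in
`Theorems/ValuativeGCTValuativeFlipTailSuffices.lean` (p117805).  A prover seated on one of the items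
lands the corresponding theorem below verbatim (`--workitem <id>`; the type is the route decl by name).

* `valuativeFlipSplit_proof : ValuativeFlipSplit` — `HeadFlip → TailFlip → ValuativeFlip`: take the head's
  slope `a/b`, `n₀ = max` of the two thresholds, case split on `b·m ≤ a·n` (= the inline argument of `closes`).
* `valuativeFlipToHead_proof : ValuativeFlipToHead` — slope `2/1`, exponent `c = 2`:
  `m ≤ 2n < 2^(log₂ n + 2) ≤ 2^((log₂ n + 2)^2)`.
* `valuativeFlipToTail_proof : ValuativeFlipToTail` — `a·n < b·m` with `b < a` forces `n ≤ m`.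
[this route, rev 4; Mulmuley–Sohoni 2001 §4]
-/

set_option linter.dupNamespace false

namespace Summit.ValiantsHypothesis.ValiantsHypothesis.Theorems.ValuativeFlip

open Summit.ValiantsHypothesis.ValiantsHypothesis.Theses.ValuativeGCT

/-- **`ValuativeFlipSplit`** (stmt-ValiantsHypothesis-15688): `HeadFlip → TailFlip → ValuativeFlip`, by the case
split on `b·m ≤ a·n` at the head's slope `a/b` with `n₀` the max of the two thresholds. [this route] -/
theorem valuativeFlipSplit_proof : ValuativeFlipSplit := by
  intro hHead hTail c
  obtain ⟨a, b, hba, n₁, hHead⟩ := hHead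
  obtain ⟨n₂, hTail⟩ := hTail a b hba c
  refine ⟨max n₁ n₂, fun n hn m _ hnm hm => ?_⟩
  by_cases hcase : b * m ≤ a * n
  · exact hHead n (le_of_max_le_left hn) m hnm hcase
  · exact hTail n (le_of_max_le_right hn) m (Nat.lt_of_not_le hcase) hm

/-- **`ValuativeFlipToHead`** (stmt-ValiantsHypothesis-15804): `ValuativeFlip → HeadFlip` with slope `2/1`, from
the window with exponent `2` (`m ≤ 2n < 2^(log₂ n + 2) ≤ 2^((log₂ n + 2)^2)`). [this route] -/
theorem valuativeFlipToHead_proof : ValuativeFlipToHead := by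
  intro hV
  obtain ⟨n₀, hn₀⟩ := hV 2
  refine ⟨2, 1, by norm_num, n₀, fun n hn m _ hnm hmn => hn₀ n hn m hnm ?_⟩
  have h1 : n < 2 ^ (Nat.log 2 n + 1) := Nat.lt_pow_succ_log_self (by norm_num) n
  have h2 : 1 * m ≤ 2 ^ (Nat.log 2 n + 2) := by
    rw [pow_succ]
    omega
  calc m = 1 * m := (one_mul m).symm
    _ ≤ 2 ^ (Nat.log 2 n + 2) := h2
    _ ≤ 2 ^ ((Nat.log 2 n + 2) ^ 2) := Nat.pow_le_pow_right (by norm_num) (by nlinarith)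

/-- **`ValuativeFlipToTail`** (stmt-ValiantsHypothesis-15805): `ValuativeFlip → TailFlip` — a tail position
`a·n < b·m` with `b < a` has `n ≤ m`, so the crux applies verbatim. [this route] -/
theorem valuativeFlipToTail_proof : ValuativeFlipToTail := by
  intro hV a b hba c
  obtain ⟨n₀, hn₀⟩ := hV c
  refine ⟨n₀, fun n hn m _ hnm hm => hn₀ n hn m ?_ hm⟩
  by_contra hlt
  have hmn : m ≤ n := by omega
  have : b * m ≤ a * n := (Nat.mul_le_mul_right m hba.le).trans (Nat.mul_le_mul_left a hmn)
  omega

end Summit.ValiantsHypothesis.ValiantsHypothesis.Theorems.ValuativeFlip
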